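import Summits.KontsevichZagierPeriods.KontsevichZagierPeriods.Theses.SymplecticScissors
import Summits.KontsevichZagierPeriods.KontsevichZagierPeriods.Theorems.SymplecticScissorsCurvePeriodsTransferRecord
import Summits.KontsevichZagierPeriods.KontsevichZagierPeriods.Theorems.RealOnePeriodRelations.Negative.Kit
import Literature.NumberTheory.Transcendental.KZCalculus
import Literature.NumberTheory.Transcendental.CurvePeriods
import Literature.NumberTheory.Transcendental.SemialgebraicMaps

/-!
# `CurvePeriodsTransfer` (stmt-KontsevichZagierPeriods-11129) — the COMPOSITION `Θ ∘ HW ∘ Ψ`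

`CurvePeriodsTransfer = (PeriodConjectureCurveType → RealOnePeriodRelations)` holds definitionally: the
Huber–Wüstholz body (HW 2022, Thm 13.3 (2), rendered on period symbols with the elementary relations
R1–R5) is the item's OWN antecedent. This file proves, once and for all, the composition step shared by
both lines attacking the item (`standard-etale-models` of this item and `nash-retraction-thin-strip` of the
sibling crux `RealOnePeriodRelations`, stmt-KontsevichZagierPeriods-10042): the item follows from

* the REALISATION `Θ` (hypothesis `hTheta`; = the registered stub `stub_realisation` of this item verbatim,
  = the conclusion of the sibling's `stub_retraction`): a map `Θ : ℂ → PeriodSymbol → FormalRep` killing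
  every `ℚ̄`-combination of elementary relations modulo `M₁ = closure (1a ∪ 1b ∪ 2 ∪ Green)` and agreeing
  modulo `M₁` with every real realisation of a symbol along a `ℚ`-semialgebraic path; and
* the NORMALISATION `Ψ` (hypothesis `hPsi`; = the registered stub `stub_normalisation` of the sibling crux
  verbatim, = the conclusion of this item's `stub_normalisation`): every `c ∈ H₁` is, modulo `M₁`, a sum of
  real realisations `[R s]` of period symbols `s` along `ℚ`-semialgebraic paths with algebraic coefficients
  `C s` and `evalCombination C = eval c`.

Proof: given `c ∈ H₁` with `eval c = 0`, `Ψ` gives `C` with `evalCombination C = 0`; the antecedent writes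
`C = Σ aₗ ρₗ` (elementary `ρₗ`, algebraic `aₗ`); `Θ` kills `Σ aₗ ρₗ` modulo `M₁` and `Θ (C s) s ≡ [R s]`, so
`c ≡ Σ_s [R s] ≡ Σ_s Θ (C s) s = (Σ aₗ ρₗ).sum Θ ≡ 0 (mod M₁)`. The closing file of the item is then
`curvePeriodsTransfer_of_theta_psi stub_realisation stub_normalisation` once both land.

References: A. Huber, G. Wüstholz, *Transcendence and Linear Relations of 1-Periods* (CUP 2022),
Thm 13.3 (2), Prop. 12.5; M. Kontsevich, D. Zagier, *Periods* (2001), §1.2.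

Maintenance record (full-build repair 2026-08-17): the route decl `SymplecticScissors.CurvePeriodsTransfer`
(stmt-KontsevichZagierPeriods-11129) was dropped from the gate-written route file by the items-cap lint
autofix of 2026-08-16T14:16:23Z; it is re-declared verbatim (original fully-qualified name, ledger
signature) by the record module `Theorems/SymplecticScissorsCurvePeriodsTransferRecord.lean`, now imported —
the only change; every statement and proof below is unchanged.
-/

noncomputable section

open scoped BigOperators
open Set MeasureTheory
open Literature.NumberTheory.Transcendental Literature.NumberTheory.Transcendental.CurvePeriods
open Literature.ModelTheory.ExponentialFields (IsSemialgebraic)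
open Summit.KontsevichZagierPeriods.SymplecticScissors.RealOnePeriodRelationsNegative (greenSet M₁ H₁)

namespace Summit.KontsevichZagierPeriods.SymplecticScissors.CurvePeriodsTransfer

/-- **`CurvePeriodsTransfer` from realisation `Θ` and normalisation `Ψ`** (registered anchor
`helper_assembly_theta_psi` of stmt-KontsevichZagierPeriods-11129; `hTheta` = this item's `stub_realisation`,
`hPsi` = the sibling crux's `stub_normalisation`, both verbatim): the Huber–Wüstholz body transported into
the dimension-one Kontsevich–Zagier calculus. [cite: HuberWustholz2022, Thm 13.3 (2)] -/
theorem curvePeriodsTransfer_of_theta_psi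
    (hTheta : ∃ Θ : ℂ → PeriodSymbol → KZ.FormalRep,
      (∀ (k : ℕ) (ρ : Fin k → (PeriodSymbol →₀ ℂ)) (a : Fin k → ℂ), (∀ l, IsElementaryRelation (ρ l)) →
        (∀ l, IsAlgebraic ℚ (a l)) → ((∑ l, a l • ρ l).sum fun s b => Θ b s) ∈ M₁) ∧
      (∀ (s : PeriodSymbol) (a : ℂ), IsAlgebraic ℚ a →
        IsSemialgebraicMapOn ℚ {z : Fin 1 → ℝ | z 0 ∈ Set.Icc (0 : ℝ) 1}
          (fun z => Fin.append (fun i => (s.γ.toFun (z 0) i).re) (fun i => (s.γ.toFun (z 0) i).im)) →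
        ∀ (r : KZ.IntegralRep 1),
          (r.domain = {z | z 0 ∈ Set.Ioo (0 : ℝ) 1} ∧ ∀ z ∈ r.domain, r.integrand z =
            (a * ∑ i, MvPolynomial.eval (s.γ.toFun (z 0)) (s.ω i) * deriv (fun u => s.γ.toFun u i) (z 0)).re) →
          Θ a s - KZ.of r ∈ M₁))
    (hPsi : ∀ c : KZ.FormalRep, c ∈ H₁ →
      ∃ (C : PeriodSymbol →₀ ℂ) (R : PeriodSymbol → KZ.IntegralRep 1), (∀ s, IsAlgebraic ℚ (C s)) ∧
        (∀ s ∈ C.support, IsSemialgebraicMapOn ℚ {z : Fin 1 → ℝ | z 0 ∈ Set.Icc (0 : ℝ) 1}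
          (fun z => Fin.append (fun i => (s.γ.toFun (z 0) i).re) (fun i => (s.γ.toFun (z 0) i).im))) ∧
        (∀ s ∈ C.support, (R s).domain = {z | z 0 ∈ Set.Ioo (0 : ℝ) 1} ∧ ∀ z ∈ (R s).domain, (R s).integrand z =
          (C s * ∑ i, MvPolynomial.eval (s.γ.toFun (z 0)) (s.ω i) * deriv (fun u => s.γ.toFun u i) (z 0)).re) ∧
        evalCombination C = ((KZ.eval c : ℝ) : ℂ) ∧ c - ∑ s ∈ C.support, KZ.of (R s) ∈ M₁) :
    Summit.KontsevichZagierPeriods.KontsevichZagierPeriods.Theses.SymplecticScissors.CurvePeriodsTransfer := by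
  unfold Summit.KontsevichZagierPeriods.KontsevichZagierPeriods.Theses.SymplecticScissors.CurvePeriodsTransfer
  intro hHW c hc heval
  change c ∈ M₁
  obtain ⟨C, R, hCalg, hSA, hReal, hCeval, hcR⟩ := hPsi c hc
  have hC0 : evalCombination C = 0 := by rw [hCeval, heval]; simp
  obtain ⟨k, ρ, a, hρ, ha, hCsum⟩ := hHW C hCalg hC0
  obtain ⟨Θ, hΘrel, hΘreal⟩ := hTheta
  -- `Σ_{s ∈ supp C} Θ (C s) s ∈ M₁`
  have h1 : (∑ s ∈ C.support, Θ (C s) s) ∈ M₁ := by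
    have h := hΘrel k ρ a hρ ha
    rw [← hCsum] at h
    exact h
  -- each `Θ (C s) s − [R s] ∈ M₁`
  have h2 : (∑ s ∈ C.support, (Θ (C s) s - KZ.of (R s))) ∈ M₁ :=
    sum_mem fun s hs => hΘreal s (C s) (hCalg s) (hSA s hs) (R s) (hReal s hs)
  have h3 : c = (c - ∑ s ∈ C.support, KZ.of (R s)) - (∑ s ∈ C.support, (Θ (C s) s - KZ.of (R s))) +
      ∑ s ∈ C.support, Θ (C s) s := by
    rw [Finset.sum_sub_distrib]
    abel
  rw [h3]
  exact M₁.add_mem (M₁.sub_mem hcR h2) h1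

/-- Registered anchor `helper_assembly_theta_psi` (stmt-KontsevichZagierPeriods-11129): `Θ → Ψ → CurvePeriodsTransfer`
(= `curvePeriodsTransfer_of_theta_psi`). [cite: HuberWustholz2022, Thm 13.3 (2)] -/
theorem helper_assembly_theta_psi : (∃ Θ : ℂ → PeriodSymbol → KZ.FormalRep, (∀ (k : ℕ) (ρ : Fin k → (PeriodSymbol →₀ ℂ)) (a : Fin k → ℂ), (∀ l, IsElementaryRelation (ρ l)) → (∀ l, IsAlgebraic ℚ (a l)) → ((∑ l, a l • ρ l).sum fun s b => Θ b s) ∈ M₁) ∧ (∀ (s : PeriodSymbol) (a : ℂ), IsAlgebraic ℚ a → IsSemialgebraicMapOn ℚ {z : Fin 1 → ℝ | z 0 ∈ Set.Icc (0 : ℝ) 1} (fun z => Fin.append (fun i => (s.γ.toFun (z 0) i).re) (fun i => (s.γ.toFun (z 0) i).im)) → ∀ (r : KZ.IntegralRep 1), (r.domain = {z | z 0 ∈ Set.Ioo (0 : ℝ) 1} ∧ ∀ z ∈ r.domain, r.integrand z = (a * ∑ i, MvPolynomial.eval (s.γ.toFun (z 0)) (s.ω i) * deriv (fun u => s.γ.toFun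 u i) (z 0)).re) → Θ a s - KZ.of r ∈ M₁)) → (∀ c : KZ.FormalRep, c ∈ H₁ → ∃ (C : PeriodSymbol →₀ ℂ) (R : PeriodSymbol → KZ.IntegralRep 1), (∀ s, IsAlgebraic ℚ (C s)) ∧ (∀ s ∈ C.support, IsSemialgebraicMapOn ℚ {z : Fin 1 → ℝ | z 0 ∈ Set.Icc (0 : ℝ) 1} (fun z => Fin.append (fun i => (s.γ.toFun (z 0) i).re) (fun i => (s.γ.toFun (z 0) i).im))) ∧ (∀ s ∈ C.support, (R s).domain = {z | z 0 ∈ Set.Ioo (0 : ℝ) 1} ∧ ∀ z ∈ (R s).domain, (R s).integrand z = (C s * ∑ i, MvPolynomial.eval (s.γ.toFun (z 0)) (s.ω i) * deriv (fun u => s.γ.toFun u i) (z 0)).re) ∧ evalCombination C = ((KZ.eval c : ℝ) : ℂ) ∧ c - ∑ s ∈ C.support, KZ.of (R s) ∈ M₁) → Summit.KontsevichZagierPeriods.KontsevichZagierPeriods.Theses.SymplecticScissors.CurvePeriodsTransfer :=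
  fun hTheta hPsi => curvePeriodsTransfer_of_theta_psi hTheta hPsi

end Summit.KontsevichZagierPeriods.SymplecticScissors.CurvePeriodsTransfer

end
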